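import Summits.ResolutionOfSingularities.ResolutionOfSingularities.Theses.RisoStrata
import Literature.AlgebraicGeometry.Resolution.NonReducedNoResolution
import Literature.AlgebraicGeometry.Resolution.AbsoluteIntegralClosureNoResolution
import Mathlib.FieldTheory.IsAlgClosed.AlgebraicClosure

/-!
# `DescentAlgclosedToPerfect` — negative lemmas I: the antecedent's hypotheses guard non-vacuity

Support (negative) lemmas for the shared crux `stmt-ResolutionOfSingularities-0550`
(`Summit.ResolutionOfSingularities.ResolutionOfSingularities.Theses.RisoStrata.DescentAlgclosedToPerfect`,
`rfl`-equal to the copies in routes Descent / UniformComplexity / EquisingularLift / TropicalLinks /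
AbhyankarShadows / TeissierJung): for every prime `p`,

  `Antecedent p` := every reduced separated scheme of finite type over every ALGEBRAICALLY CLOSED
  field of characteristic `p` has a resolution of singularities, implies
  `Consequent p` := the same over every PERFECT field of characteristic `p`.

Filed by the standing disprover (cdisprove gen 1; work file
`Cruxes/DescentAlgclosedToPerfect/Disproof.lean`; companion file `Negative/LoadBearing.lean`
treats the consequent's hypotheses, irrefutability and the degree obstruction). The file declares
NO definition: every dropped-hypothesis variant is written out inline.

## Findings (all sorry-free)

* `antecedent_false_without_isReduced` — with `IsReduced X` dropped, the ANTECEDENT is false at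
  every prime: `Spec 𝔽̄_p[ε] → Spec 𝔽̄_p` is affine and of finite type over the algebraically
  closed field `𝔽̄_p`, and `Spec 𝔽̄_p[ε]` has no resolution
  (`Literature.AlgebraicGeometry.Resolution.not_hasResolution_spec_dualNumber`).
* `antecedent_false_without_locallyOfFiniteType` — with `LocallyOfFiniteType f` dropped, the
  ANTECEDENT is false at every prime: `Spec 𝔽̄_p[X]⁺ → Spec 𝔽̄_p`, the absolute integral closure
  of the affine line (affine, reduced, no resolution: every non-generic stalk is non-Noetherian).
  The witness lemmas of `Literature/…/AbsoluteIntegralClosureNoResolution.lean` (stated there over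
  `𝔽_p`) are re-run here over an ARBITRARY ground field `F`
  (`absoluteIntegralClosure_algebraMap_injective`, `…_exists_sq_eq`, `…_exists_prime_not_mem`,
  `not_hasResolution_spec_absoluteIntegralClosure`).
* Hence either mutation makes the crux hold VACUOUSLY
  (`descentAlgclosedToPerfect_without_isReduced_antecedent`,
  `descentAlgclosedToPerfect_without_locallyOfFiniteType_antecedent`): reducedness and finite type
  of the schemes fed to the antecedent are exactly what keeps the hypothesis of the crux
  satisfiable — a "proof" of the crux exploiting non-reduced or non-finite-type auxiliary schemes
  over `k̄` proves nothing, and conversely any genuine proof may feed the antecedent only reduced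
  finite-type `k̄`-schemes (e.g. `X_{k̄}` for `X` over a perfect `k`, which is reduced because `k`
  is perfect — the one place where perfectness of `k` enters).

## Sources
* M. Artin, *On the joins of Hensel rings*, Adv. Math. 7 (1971) 282–296 (absolute integral
  closure); the Noetherian-root-closed-local-ring argument is folklore.
* The Stacks Project, Tag 01RN (birational), Tag 02IS (regular), Tag 00FZ (lying over).
* Witness files of the tree: `NonReducedNoResolution.lean`, `AbsoluteIntegralClosureNoResolution.lean`.
-/

noncomputable section

open CategoryTheory AlgebraicGeometry TopologicalSpace
open Literature.AlgebraicGeometry.Resolution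

set_option linter.dupNamespace false -- mandated namespace of this single-conjunct summit

namespace Summit.ResolutionOfSingularities.ResolutionOfSingularities.Theorems.DescentAlgclosedToPerfect.Negative

/-! ## §1 The antecedent's hypotheses guard non-vacuity -/

/-- **The antecedent with `IsReduced X` dropped is false at every prime**: witness
`Spec 𝔽̄_p[ε] → Spec 𝔽̄_p` (affine, of finite type over the algebraically closed field `𝔽̄_p`;
`Spec 𝔽̄_p[ε]` has no resolution, `not_hasResolution_spec_dualNumber`). [folklore] -/
theorem antecedent_false_without_isReduced (p : ℕ) [Fact p.Prime] :
    ¬ ∀ (k : Type) [Field k] [CharP k p] [IsAlgClosed k] (X : Scheme.{0})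
        (f : X ⟶ Spec (.of k)), IsSeparated f → LocallyOfFiniteType f → QuasiCompact f →
          Scheme.HasResolution X := by
  intro h
  let K : Type := AlgebraicClosure (ZMod p)
  haveI : Module.Finite K (DualNumber K) := inferInstanceAs (Module.Finite K (K × K))
  let f : Spec (.of (DualNumber K)) ⟶ Spec (.of K) :=
    Spec.map (CommRingCat.ofHom (algebraMap K (DualNumber K)))
  haveI : LocallyOfFiniteType f :=
    (HasRingHomProperty.Spec_iff (P := @LocallyOfFiniteType)).mpr
      (RingHom.finiteType_algebraMap.mpr inferInstance)
  exact not_hasResolution_spec_dualNumber K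
    (h K (Spec (.of (DualNumber K))) f inferInstance inferInstance inferInstance)

/-- **Hence the crux with `IsReduced X` dropped from the ANTECEDENT holds vacuously** (at every
prime the mutated antecedent is refuted by `Spec 𝔽̄_p[ε]`): reducedness of the schemes fed to the
antecedent is what keeps the hypothesis satisfiable. [folklore] -/
theorem descentAlgclosedToPerfect_without_isReduced_antecedent :
    ∀ p : ℕ, p.Prime →
      (∀ (k : Type) [Field k] [CharP k p] [IsAlgClosed k] (X : Scheme.{0})
          (f : X ⟶ Spec (.of k)), IsSeparated f → LocallyOfFiniteType f → QuasiCompact f →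
            Scheme.HasResolution X) →
        ∀ (k : Type) [Field k] [CharP k p] [PerfectField k] (X : Scheme.{0})
          (f : X ⟶ Spec (.of k)), IsSeparated f → LocallyOfFiniteType f → QuasiCompact f →
            IsReduced X → Scheme.HasResolution X := by
  intro p hp hA
  haveI : Fact p.Prime := ⟨hp⟩
  exact absurd hA (antecedent_false_without_isReduced p)

section AbsoluteIntegralClosure

open Polynomial

variable (F : Type) [Field F]

/-- `F[X] → F[X]⁺` (the integral closure of `F[X]` in an algebraic closure of `F(X)`) is injective,
for any field `F`. [folklore] -/
theorem absoluteIntegralClosure_algebraMap_injective :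
    Function.Injective (algebraMap F[X]
      ↥(integralClosure F[X] (AlgebraicClosure (RatFunc F)))) := by
  have h : Function.Injective (algebraMap F[X] (AlgebraicClosure (RatFunc F))) := by
    rw [IsScalarTower.algebraMap_eq F[X] (RatFunc F) (AlgebraicClosure (RatFunc F))]
    exact (algebraMap (RatFunc F) _).injective.comp (RatFunc.algebraMap_injective F)
  intro a b hab
  apply h
  have := congrArg
    (fun x : ↥(integralClosure F[X] (AlgebraicClosure (RatFunc F))) =>
      (x : AlgebraicClosure (RatFunc F))) hab
  simpa using this

/-- Every element of `F[X]⁺` is a square (roots of integral elements are integral). [folklore] -/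
theorem absoluteIntegralClosure_exists_sq_eq
    (a : ↥(integralClosure F[X] (AlgebraicClosure (RatFunc F)))) :
    ∃ b : ↥(integralClosure F[X] (AlgebraicClosure (RatFunc F))), b ^ 2 = a := by
  obtain ⟨z, hz⟩ := IsAlgClosed.exists_pow_nat_eq (a : AlgebraicClosure (RatFunc F)) two_pos
  have hzint : IsIntegral F[X] z := IsIntegral.of_pow two_pos (by rw [hz]; exact a.2)
  exact ⟨⟨z, hzint⟩, Subtype.ext hz⟩

/-- The generic point of `Spec F[X]⁺` is not open: every non-zero `f` avoids some non-zero prime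
(a prime lying over `(π)`, `π` an irreducible factor of `c·X + 1`, `c ≠ 0` the constant term of an
integral equation of `f`; Stacks 00FZ). [folklore] -/
theorem absoluteIntegralClosure_exists_prime_not_mem
    (f : ↥(integralClosure F[X] (AlgebraicClosure (RatFunc F)))) (hf : f ≠ 0) :
    ∃ Q : Ideal ↥(integralClosure F[X] (AlgebraicClosure (RatFunc F))),
      Q.IsPrime ∧ Q ≠ ⊥ ∧ f ∉ Q := by
  have hinj := absoluteIntegralClosure_algebraMap_injective F
  obtain ⟨P, hPm, hPf⟩ := (integralClosure.isIntegral f : IsIntegral F[X] f)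
  obtain ⟨P', hP, hXP'⟩ := P.exists_eq_pow_rootMultiplicity_mul_and_not_dvd hPm.ne_zero 0
  simp only [map_zero, sub_zero] at hP hXP'
  set c := P'.coeff 0 with hc_def
  have hc : c ≠ 0 := fun h0 => hXP' (Polynomial.X_dvd_iff.mpr h0)
  have hP'f : Polynomial.aeval f P' = 0 := by
    have h1 : Polynomial.aeval f P = 0 := hPf
    rw [hP, map_mul, map_pow, Polynomial.aeval_X] at h1
    exact (mul_eq_zero.mp h1).resolve_left (pow_ne_zero _ hf)
  have hrel : algebraMap F[X] _ c = -(Polynomial.aeval f P'.divX * f) := by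
    have h1 := hP'f
    rw [← Polynomial.divX_mul_X_add P', map_add, map_mul, Polynomial.aeval_X,
      Polynomial.aeval_C] at h1
    linear_combination h1
  have hdeg : (c * X + 1 : F[X]).natDegree = c.natDegree + 1 := by
    rw [Polynomial.natDegree_add_eq_left_of_natDegree_lt] <;>
      rw [Polynomial.natDegree_mul_X hc]
    simp
  have hne : (c * X + 1 : F[X]) ≠ 0 := by
    intro h0; rw [h0] at hdeg; simp at hdeg
  have hnu : ¬ IsUnit (c * X + 1 : F[X]) := by
    intro hu
    have := Polynomial.natDegree_eq_zero_of_isUnit hu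
    omega
  obtain ⟨π, hπirr, hπdvd⟩ := WfDvdMonoid.exists_irreducible_factor hnu hne
  have hπc : ¬ π ∣ c := by
    intro hdc
    apply hπirr.not_isUnit
    have : π ∣ (c * X + 1) - c * X := dvd_sub hπdvd (dvd_mul_of_dvd_left hdc _)
    exact isUnit_of_dvd_one (by simpa using this)
  let 𝔭 : Ideal F[X] := Ideal.span {π}
  haveI h𝔭 : 𝔭.IsPrime := (Ideal.span_singleton_prime hπirr.ne_zero).mpr hπirr.prime
  obtain ⟨Q, -, hQ, hQcomap⟩ := Ideal.exists_ideal_over_prime_of_isIntegral 𝔭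
    (⊥ : Ideal ↥(integralClosure F[X] (AlgebraicClosure (RatFunc F))))
    (by
      intro a ha
      have ha0 : algebraMap F[X]
          ↥(integralClosure F[X] (AlgebraicClosure (RatFunc F))) a = 0 :=
        Ideal.mem_bot.mp (Ideal.mem_comap.mp ha)
      have : a = 0 := hinj (by rw [ha0, map_zero])
      rw [this]; exact 𝔭.zero_mem)
  refine ⟨Q, hQ, ?_, ?_⟩
  · rintro rfl
    have hπmem : π ∈ (⊥ : Ideal ↥(integralClosure F[X]
        (AlgebraicClosure (RatFunc F)))).comap (algebraMap F[X] _) := by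
      rw [hQcomap]; exact Ideal.mem_span_singleton_self π
    have hπ0 : algebraMap F[X]
        ↥(integralClosure F[X] (AlgebraicClosure (RatFunc F))) π = 0 :=
      Ideal.mem_bot.mp (Ideal.mem_comap.mp hπmem)
    exact hπirr.ne_zero (hinj (by rw [hπ0, map_zero]))
  · intro hfQ
    have h1 : algebraMap F[X] _ c ∈ Q := by
      rw [hrel]; exact Q.neg_mem (Q.mul_mem_left _ hfQ)
    have h2 : c ∈ 𝔭 := by rw [← hQcomap]; exact h1
    exact hπc (Ideal.mem_span_singleton.mp h2)

/-- **`Spec F[X]⁺` has no resolution of singularities**, for any field `F`: a dense open contains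
a non-generic point, whose stalk would be a regular, in particular Noetherian, local ring of a
square-root-closed domain — forcing it to be the generic point
(`not_hasResolution_spec_of_forall_exists_pow_eq`). [folklore] -/
theorem not_hasResolution_spec_absoluteIntegralClosure :
    ¬ Scheme.HasResolution
      (Spec (.of ↥(integralClosure F[X] (AlgebraicClosure (RatFunc F))))) :=
  not_hasResolution_spec_of_forall_exists_pow_eq _ le_rfl (absoluteIntegralClosure_exists_sq_eq F)
    (absoluteIntegralClosure_exists_prime_not_mem F)

end AbsoluteIntegralClosure

/-- **The antecedent with `LocallyOfFiniteType f` dropped is false at every prime**: witness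
`Spec 𝔽̄_p[X]⁺ → Spec 𝔽̄_p` (affine, hence separated and quasi-compact; reduced, the spectrum of
a domain; no resolution). [folklore] -/
theorem antecedent_false_without_locallyOfFiniteType (p : ℕ) [Fact p.Prime] :
    ¬ ∀ (k : Type) [Field k] [CharP k p] [IsAlgClosed k] (X : Scheme.{0})
        (f : X ⟶ Spec (.of k)), IsSeparated f → QuasiCompact f → IsReduced X →
          Scheme.HasResolution X := by
  intro h
  let K : Type := AlgebraicClosure (ZMod p)
  let f : Spec (.of ↥(integralClosure (Polynomial K) (AlgebraicClosure (RatFunc K)))) ⟶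
      Spec (.of K) :=
    Spec.map (CommRingCat.ofHom ((algebraMap (Polynomial K)
      ↥(integralClosure (Polynomial K) (AlgebraicClosure (RatFunc K)))).comp Polynomial.C))
  exact not_hasResolution_spec_absoluteIntegralClosure K
    (h K _ f inferInstance inferInstance inferInstance)

/-- **Hence the crux with `LocallyOfFiniteType f` dropped from the ANTECEDENT holds vacuously.**
[folklore] -/
theorem descentAlgclosedToPerfect_without_locallyOfFiniteType_antecedent :
    ∀ p : ℕ, p.Prime →
      (∀ (k : Type) [Field k] [CharP k p] [IsAlgClosed k] (X : Scheme.{0})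
          (f : X ⟶ Spec (.of k)), IsSeparated f → QuasiCompact f → IsReduced X →
            Scheme.HasResolution X) →
        ∀ (k : Type) [Field k] [CharP k p] [PerfectField k] (X : Scheme.{0})
          (f : X ⟶ Spec (.of k)), IsSeparated f → LocallyOfFiniteType f → QuasiCompact f →
            IsReduced X → Scheme.HasResolution X := by
  intro p hp hA
  haveI : Fact p.Prime := ⟨hp⟩
  exact absurd hA (antecedent_false_without_locallyOfFiniteType p)

end Summit.ResolutionOfSingularities.ResolutionOfSingularities.Theorems.DescentAlgclosedToPerfect.Negative

end
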